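import Literature.AlgebraicGeometry.AbelianSchemes.AbelianSchemeOverGlueDataTripleCocycle
import Literature.AlgebraicGeometry.AbelianSchemes.PolarizedTripleRigidityDescent
import HarnessLib

/-!
# Gluing polarised triples from slice triples and transition relations over ARBITRARY locally Noetherian slices:
# the slice unit hypotheses as a binder (F-8 (σ2), the reducedness-free form of ★ `glueTripleOfTransitions`)

Topic `AlgebraicGeometry/AbelianSchemes`; namespace `Literature.AlgebraicGeometry.AbelianSchemes.PolarizedAbelianSchemeWithLevel`.
Cell hodgecm-mathlib (D-0151), F-8 (σ2) (B-p04 (g20); B-plan1 (g16) 08:46:52Z/08:52:08Z), consumer F-8 (8δ)/(8ε) (B-p08 (g13)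
`SiegelModuliOfOpenCharts` `obtain`s the glued triple and its charts).  THEOREMS ONLY (no def, no instance, no notation, no `sorry`).

★ (E) `AbelianSchemeOverGlueDataTripleCocycle.glueTripleOfTransitions` (and ★ FILE J `glueTripleOfTriples`) carry
`[∀ i, IsReduced (D.U i)]` for exactly ONE reason: to discharge the slice unit hypotheses
`unit i : 𝒫ᵢ|_{Aᵢ × {ε_{Âᵢ}}} ≅ 𝒪` of ★ FILE C `CocycleDatum.glueTriple … unit₀ unit` by ★ `Polarization.nonempty_unitHatSlice_iso`
([MumfordAV1970, §5 Cor. 6]: a fibrewise-trivial rigidified line bundle is trivial over a REDUCED base).  Over an arbitrary locally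
Noetherian slice `unit i` is a genuine condition on the dual pair (the group law of `Âᵢ` is not tied to `𝒫ᵢ`, cf. ★
`AbelianSchemeDualPairNormalize`) and it is NECESSARY for the chart relation into a glued pair normalised along `Z × {ε}` (the Poincaré
clause of `IsBaseChangeVia` on the unit slice) — so the reducedness-free statement takes `unit` as a BINDER, and the consumer discharges it
BY NAME: reduced slices ★ `CocycleDatum.unit_of_isReduced`; slices that are restrictions of ONE family whose dual pair satisfies it ★
`DualPair.nonempty_unitHatSlice_baseChange_iso`; renormalised pairs ★ `DualPair.nonempty_unitHatSlice_iso_normalize`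
([MumfordFogartyKirwan1994, Ch. 6 §2 p. 121]).

* **`exists_glueTriple_of_transitions (P) (θ) (θhat) (R) (hΩ) (D₀) (hδ) (unit)`** — `∃ Z` over `A⁰ = D.glued` with `Z.A =` the glued
  family `⋃ Aᵢ`, `Z.D.hat = D₀.hat`, and charts `G Ĝ` with `∀ i, (P i).IsBaseChangeVia Z (D.ι i) (G i) (Ĝ i)` (all five clauses of
  [MumfordFogartyKirwan1994, Def. 7.2]); witness ★ FILE C `CocycleDatum.glueTriple` on `D₀.normalize`, `hcoc` by ★ `hcoc_of_transitions`
  (triple rigidity), `unit`;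
* `exists_glueTriple_of_transitions_of_isReduced` — §3 of ★ (E) in the same `∃`-form (reduced slices);
* §2 **`exists_glueTriple_of_transitions_of_three_le (fU : ∀ i, Uᵢ ⟶ Spec ℚ) (hN : 3 ≤ N) … (unit)`** — over locally Noetherian
  ℚ-slices NEITHER `IsReduced` NOR the field-level rigidity hypothesis `hΩ` of ★ (E) is needed: `θᵢᵢ = 𝟙`
  (`θ_self_eq_id_of_three_le`) and the cocycle condition (`relativeT'_cocycle_of_three_le`) come from ★
  `eq_id_and_hat_eq_id_of_three_le` ([MumfordFogartyKirwan1994] Ch. 7 §3 lemma of Serre, unconditional for `3 ≤ N` over ℚ-schemes)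
  over the ℚ-schemes `V(i,i)`, `V(i,j) ×_{Uᵢ} V(i,k)` — the form the F-8 assembly over `Spec ℚ` consumes.

HC_CM is proved only modulo the printed citations until rung 0 closes; this file discharges none of them.

## References
* [MumfordFogartyKirwan1994] D. Mumford, J. Fogarty, F. Kirwan, *Geometric Invariant Theory*, 3rd ed. (1994), Ch. 7 §2 Def. 7.2
  (p. 129); Ch. 6 §2 (p. 121); Ch. 7 §3, remark after Thm. 7.9 (p. 139) (lemma of Serre).
* [MumfordAV1970] D. Mumford, *Abelian Varieties* (1970), §5 Cor. 6 (p. 54).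
* [Deligne1971TravauxShimura] P. Deligne, *Travaux de Shimura*, Sém. Bourbaki 389 (1971), 4.16 (p. 150).
* [StacksProject] The Stacks Project, Tag 01LH (Relative glueing).
-/

universe u

open CategoryTheory CategoryTheory.Limits AlgebraicGeometry MonoidalCategory
open Literature.AlgebraicGeometry.Morphisms

noncomputable section

namespace Literature.AlgebraicGeometry.AbelianSchemes

namespace PolarizedAbelianSchemeWithLevel

open AbelianSchemeOver
open Literature.AlgebraicGeometry.ModuliOfAbelianVarieties (IsPolarizationType)
open scoped MonObj

/-! ### §1 The slice unit hypotheses as a binder (field rigidity `hΩ` kept) -/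

section UnitBinder

variable {g N : ℕ} {δ : Fin g → ℕ} {D : Scheme.GlueData.{u}}
  (P : ∀ i : D.J, PolarizedAbelianSchemeWithLevel g N δ (D.U i))
  (θ : ∀ i j, pullback (P i).A.X.hom (D.f i j) ⟶ pullback (P j).A.X.hom (D.f j i))
  (θhat : ∀ i j, ((P i).D.baseChange (D.f i j)).hat.X.left ⟶ ((P j).D.baseChange (D.f j i)).hat.X.left)
  (R : ∀ i j, ((P i).baseChange (D.f i j)).IsBaseChangeVia ((P j).baseChange (D.f j i)) (D.t i j) (θ i j) (θhat i j))
  (hΩ : ∀ ⦃Ω : Type u⦄ [Field Ω] [IsAlgClosed Ω] (Q : PolarizedAbelianSchemeWithLevel g N δ (Spec (.of Ω)))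
    (H : Q.A.X.left ⟶ Q.A.X.left) (Ĥ : Q.D.hat.X.left ⟶ Q.D.hat.X.left), Q.IsBaseChangeVia Q (𝟙 _) H Ĥ → H = 𝟙 _)
  [∀ i, IsLocallyNoetherian (D.U i)]

include R hΩ in
/-- **GLUING FROM SLICE TRIPLES AND TRANSITION RELATIONS ALONE, over ARBITRARY locally Noetherian slices** ([MumfordFogartyKirwan1994]
Ch. 7 §2 Def. 7.2 with §3's lemma of Serre; ed. 2 of `glueTripleOfTransitions`/`isBaseChangeVia_glueTripleOfTransitions`): from slice
triples `Pᵢ`, pairwise five-clause transition relations `R i j`, the field-level rigidity hypothesis `hΩ`, ANY dual pair `D₀` of the glued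
family `⋃ Aᵢ → A⁰` and the slice unit hypotheses `unit`, there is a triple `Z` over `A⁰ = D.glued` whose abelian scheme IS the glued family
and whose dual abelian scheme IS `D₀`'s, with CARTESIAN CHARTS: every `Pᵢ` is the pull-back of `Z` along `Uᵢ ↪ A⁰` (all five clauses of
★ `PolarizedAbelianSchemeWithLevel.IsBaseChangeVia`).  Witness: ★ FILE C `CocycleDatum.glueTriple` on the inputs read off the `R i j`,
`D₀.normalize`, `hcoc` from §3 and `unit`. [cite: MumfordFogartyKirwan1994, Ch. 7 §2 Definition 7.2 (p. 129)]
[cite: MumfordFogartyKirwan1994, Ch. 6 §2 (p. 121)] [cite: StacksProject, Tag 01LH] -/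
theorem exists_glueTriple_of_transitions
    (D₀ : (cocycleDatumOfTriples P θ θhat R hΩ (hcoc_of_transitions P θ θhat R hΩ)).abelianScheme.DualPair)
    (hδ : IsPolarizationType δ)
    (unit : ∀ i, Nonempty ((Scheme.Modules.pullback (DualPair.unitHatSlice (P i).D)).obj (P i).D.P ≅ SheafOfModules.unit _)) :
    ∃ (Z : PolarizedAbelianSchemeWithLevel g N δ D.glued)
      (_ : Z.A = (cocycleDatumOfTriples P θ θhat R hΩ (hcoc_of_transitions P θ θhat R hΩ)).abelianScheme)
      (_ : Z.D.hat = D₀.hat) (G : ∀ i, (P i).A.X.left ⟶ Z.A.X.left) (Ĝ : ∀ i, (P i).D.hat.X.left ⟶ Z.D.hat.X.left),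
      ∀ i, (P i).IsBaseChangeVia Z (D.ι i) (G i) (Ĝ i) :=
  ⟨(cocycleDatumOfTriples P θ θhat R hΩ (hcoc_of_transitions P θ θhat R hΩ)).glueTriple (fun i => (P i).D)
      (fun i => (P i).pol) θhat (fun i j => (R i j).2.2.1) (fun i j => (R i j).2.2.2) D₀.normalize (fun i => (P i).level)
      (fun i j => (R i j).1) (fun i => (P i).relDim) hδ (fun i => (P i).hasType) (fun i => (P i).symplectic)
      D₀.nonempty_unitHatSlice_iso_normalize unit,
    rfl, rfl, fun i => (cocycleDatumOfTriples P θ θhat R hΩ (hcoc_of_transitions P θ θhat R hΩ)).total.ι i,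
    fun i => (cocycleDatumOfTriples P θ θhat R hΩ (hcoc_of_transitions P θ θhat R hΩ)).Ĝ (fun i => (P i).D)
      (fun i => (P i).pol) θhat (fun i j => (R i j).2.2.1) (fun i j => (R i j).2.2.2) D₀.normalize i,
    fun i => (cocycleDatumOfTriples P θ θhat R hΩ (hcoc_of_transitions P θ θhat R hΩ)).isBaseChangeVia_chartTriple
      (fun i => (P i).D) (fun i => (P i).pol) θhat (fun i j => (R i j).2.2.1) (fun i j => (R i j).2.2.2) D₀.normalize
      (fun i => (P i).level) (fun i j => (R i j).1) (fun i => (P i).relDim) hδ (fun i => (P i).hasType)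
      (fun i => (P i).symplectic) D₀.nonempty_unitHatSlice_iso_normalize unit i⟩

include R hΩ in
/-- The same with `unit` discharged over REDUCED slices (★ `CocycleDatum.unit_of_isReduced`): §3's glued triple in `∃`-form.
[cite: MumfordFogartyKirwan1994, Ch. 7 §2 Definition 7.2 (p. 129)] [cite: MumfordAV1970, §5 Cor. 6 (p. 54)] -/
theorem exists_glueTriple_of_transitions_of_isReduced [∀ i, IsReduced (D.U i)]
    (D₀ : (cocycleDatumOfTriples P θ θhat R hΩ (hcoc_of_transitions P θ θhat R hΩ)).abelianScheme.DualPair)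
    (hδ : IsPolarizationType δ) :
    ∃ (Z : PolarizedAbelianSchemeWithLevel g N δ D.glued)
      (_ : Z.A = (cocycleDatumOfTriples P θ θhat R hΩ (hcoc_of_transitions P θ θhat R hΩ)).abelianScheme)
      (_ : Z.D.hat = D₀.hat) (G : ∀ i, (P i).A.X.left ⟶ Z.A.X.left) (Ĝ : ∀ i, (P i).D.hat.X.left ⟶ Z.D.hat.X.left),
      ∀ i, (P i).IsBaseChangeVia Z (D.ι i) (G i) (Ĝ i) :=
  exists_glueTriple_of_transitions P θ θhat R hΩ D₀ hδ
    ((cocycleDatumOfTriples P θ θhat R hΩ (hcoc_of_transitions P θ θhat R hΩ)).unit_of_isReduced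
      (fun i => (P i).D) (fun i => (P i).pol))


end UnitBinder

/-! ### §2 Over locally Noetherian ℚ-slices: NO field-level rigidity hypothesis `hΩ` either

★ (E)/FILE J take the field-level rigidity hypothesis `hΩ` («triples over algebraically closed fields have no automorphisms», all
characteristics) as a binder.  Over locally Noetherian ℚ-schemes triple rigidity is ★ UNCONDITIONAL (★ `eq_id_and_hat_eq_id_of_three_le`,
[MumfordFogartyKirwan1994] Ch. 7 §3 lemma of Serre / [Deligne1971TravauxShimura] 4.16, for `3 ≤ N`), and the two uses of `hΩ` — `θᵢᵢ = 𝟙`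
and the cocycle condition — happen over the ℚ-schemes `V(i,i)` and `V(i,j) ×_{Uᵢ} V(i,k)`.  So for slices with structure maps
`fU i : Uᵢ ⟶ Spec ℚ` and `3 ≤ N` both `hΩ` and `IsReduced` disappear: `exists_glueTriple_of_transitions_of_three_le`. -/

section OverRat

variable {g N : ℕ} {δ : Fin g → ℕ} {D : Scheme.GlueData.{0}}
  (P : ∀ i : D.J, PolarizedAbelianSchemeWithLevel g N δ (D.U i))
  (θ : ∀ i j, pullback (P i).A.X.hom (D.f i j) ⟶ pullback (P j).A.X.hom (D.f j i))
  (θhat : ∀ i j, ((P i).D.baseChange (D.f i j)).hat.X.left ⟶ ((P j).D.baseChange (D.f j i)).hat.X.left)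
  (R : ∀ i j, ((P i).baseChange (D.f i j)).IsBaseChangeVia ((P j).baseChange (D.f j i)) (D.t i j) (θ i j) (θhat i j))
  [∀ i, IsLocallyNoetherian (D.U i)] (fU : ∀ i, D.U i ⟶ Spec (.of ℚ)) (hN : 3 ≤ N)

include R fU hN in
/-- **`θ i i = 𝟙` over ℚ-slices, from `3 ≤ N`**: `R i i` is a self-relation of `Pᵢ|_{V(i,i)}` along `D.t i i = 𝟙` (Mathlib
`Scheme.GlueData.t_id`), trivial by ★ `eq_id_and_hat_eq_id_of_three_le` over the ℚ-scheme `V(i,i)`.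
[cite: MumfordFogartyKirwan1994, Ch. 7 §3, remark after Theorem 7.9 (p. 139)] [cite: MumfordFogartyKirwan1994, Ch. 7 §2 Definition 7.2 (p. 129)] -/
theorem θ_self_eq_id_of_three_le (i : D.J) : θ i i = 𝟙 _ := by
  haveI : IsLocallyNoetherian (D.V (i, i)) := isLocallyNoetherian_of_isOpenImmersion (D.f i i)
  have h : ((P i).baseChange (D.f i i)).IsBaseChangeVia ((P i).baseChange (D.f i i)) (𝟙 _) (θ i i) (θhat i i) :=
    (congrArg (fun x => ((P i).baseChange (D.f i i)).IsBaseChangeVia ((P i).baseChange (D.f i i)) x (θ i i) (θhat i i))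
      (D.t_id i)).mp (R i i)
  exact (eq_id_and_hat_eq_id_of_three_le (D.f i i ≫ fU i) hN _ h).1

include R fU hN in
/-- **THE COCYCLE CONDITION over ℚ-slices, from `3 ≤ N`** (★ (E) `relativeT'_cocycle` with its last step — triple rigidity on the
relative triple overlap — taken from ★ `eq_id_and_hat_eq_id_of_three_le` over the ℚ-scheme `V(i,j) ×_{Uᵢ} V(i,k)` instead of `hΩ`).
[cite: MumfordFogartyKirwan1994, Ch. 7 §3, remark after Theorem 7.9 (p. 139)] [cite: StacksProject, Tag 01LH] -/
theorem relativeT'_cocycle_of_three_le (i j k : D.J) :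
    relativeT' D (fun i => (P i).A.X.left) (fun i => (P i).A.X.hom) θ (fun i j => (R i j).1.1.fst) i j k ≫
      relativeT' D (fun i => (P i).A.X.left) (fun i => (P i).A.X.hom) θ (fun i j => (R i j).1.1.fst) j k i ≫
        relativeT' D (fun i => (P i).A.X.left) (fun i => (P i).A.X.hom) θ (fun i j => (R i j).1.1.fst) k i j = 𝟙 _ := by
  obtain ⟨m₁, mh₁, hm₁G, r₁⟩ := exists_transition P θ θhat R i j k
  obtain ⟨m₂, mh₂, hm₂G, r₂⟩ := exists_transition P θ θhat R j k i
  obtain ⟨m₃, mh₃, hm₃G, r₃⟩ := exists_transition P θ θhat R k i j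
  rw [relativeT'_eq_conj P θ θhat R i j k m₁ hm₁G r₁.1.1.fst, relativeT'_eq_conj P θ θhat R j k i m₂ hm₂G r₂.1.1.fst,
    relativeT'_eq_conj P θ θhat R k i j m₃ hm₃G r₃.1.1.fst]
  have r := (r₁.trans r₂).trans r₃
  have hbase : (D.t' i j k ≫ D.t' j k i) ≫ D.t' k i j = 𝟙 _ := (Category.assoc _ _ _).trans (D.cocycle i j k)
  have r' : (((P i).baseChange (D.f i j)).baseChange (pullback.fst (D.f i j) (D.f i k))).IsBaseChangeVia
      (((P i).baseChange (D.f i j)).baseChange (pullback.fst (D.f i j) (D.f i k))) (𝟙 _) ((m₁ ≫ m₂) ≫ m₃)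
      ((mh₁ ≫ mh₂) ≫ mh₃) :=
    (congrArg (fun x => (((P i).baseChange (D.f i j)).baseChange (pullback.fst (D.f i j) (D.f i k))).IsBaseChangeVia
      (((P i).baseChange (D.f i j)).baseChange (pullback.fst (D.f i j) (D.f i k))) x ((m₁ ≫ m₂) ≫ m₃)
      ((mh₁ ≫ mh₂) ≫ mh₃)) hbase).mp r
  haveI : IsLocallyNoetherian (pullback (D.f i j) (D.f i k)) :=
    isLocallyNoetherian_of_isOpenImmersion (pullback.fst (D.f i j) (D.f i k) ≫ D.f i j)
  have hid : (m₁ ≫ m₂) ≫ m₃ = 𝟙 _ :=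
    (eq_id_and_hat_eq_id_of_three_le ((pullback.fst (D.f i j) (D.f i k) ≫ D.f i j) ≫ fU i) hN _ r').1
  have hid' : m₁ ≫ m₂ ≫ m₃ = 𝟙 _ := (Category.assoc _ _ _).symm.trans hid
  simp only [Category.assoc, Iso.inv_hom_id_assoc]
  rw [reassoc_of% hid', Iso.hom_inv_id]

include R fU hN in
/-- **GLUING OVER LOCALLY NOETHERIAN ℚ-SLICES, `3 ≤ N`: no `IsReduced`, no `hΩ`** — from slice triples `Pᵢ`, pairwise five-clause
transition relations `R i j`, ANY dual pair `D₀` of the glued family and the slice unit hypotheses `unit`, there is a triple `Z` over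
`A⁰ = D.glued` with `Z.D.hat = D₀.hat` and CARTESIAN CHARTS `∀ i, (P i).IsBaseChangeVia Z (D.ι i) (G i) (Ĝ i)`.  Witness: ★ FILE C
`CocycleDatum.glueTriple` on the cocycle datum `(Pᵢ.A, θ, (R i j).1.1, θᵢᵢ = 𝟙, cocycle)` built from `θ_self_eq_id_of_three_le` /
`relativeT'_cocycle_of_three_le`, with `D₀.normalize` and `unit` — the form F-8 (8δ)/(8ε) `obtain`s over `Spec ℚ`.
[cite: MumfordFogartyKirwan1994, Ch. 7 §2 Definition 7.2 (p. 129)] [cite: MumfordFogartyKirwan1994, Ch. 7 §3, remark after Theorem 7.9 (p. 139)]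
[cite: MumfordFogartyKirwan1994, Ch. 6 §2 (p. 121)] [cite: StacksProject, Tag 01LH] -/
theorem exists_glueTriple_of_transitions_of_three_le
    (D₀ : (⟨fun i => (P i).A, θ, fun i j => (R i j).1.1, θ_self_eq_id_of_three_le P θ θhat R fU hN,
      relativeT'_cocycle_of_three_le P θ θhat R fU hN⟩ : CocycleDatum D).abelianScheme.DualPair)
    (hδ : IsPolarizationType δ)
    (unit : ∀ i, Nonempty ((Scheme.Modules.pullback (DualPair.unitHatSlice (P i).D)).obj (P i).D.P ≅ SheafOfModules.unit _)) :
    ∃ (Z : PolarizedAbelianSchemeWithLevel g N δ D.glued)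
      (_ : Z.A = (⟨fun i => (P i).A, θ, fun i j => (R i j).1.1, θ_self_eq_id_of_three_le P θ θhat R fU hN,
        relativeT'_cocycle_of_three_le P θ θhat R fU hN⟩ : CocycleDatum D).abelianScheme)
      (_ : Z.D.hat = D₀.hat) (G : ∀ i, (P i).A.X.left ⟶ Z.A.X.left) (Ĝ : ∀ i, (P i).D.hat.X.left ⟶ Z.D.hat.X.left),
      ∀ i, (P i).IsBaseChangeVia Z (D.ι i) (G i) (Ĝ i) := by
  let 𝔊 : CocycleDatum D := ⟨fun i => (P i).A, θ, fun i j => (R i j).1.1, θ_self_eq_id_of_three_le P θ θhat R fU hN,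
    relativeT'_cocycle_of_three_le P θ θhat R fU hN⟩
  exact ⟨𝔊.glueTriple (fun i => (P i).D) (fun i => (P i).pol) θhat (fun i j => (R i j).2.2.1) (fun i j => (R i j).2.2.2)
      D₀.normalize (fun i => (P i).level) (fun i j => (R i j).1) (fun i => (P i).relDim) hδ (fun i => (P i).hasType)
      (fun i => (P i).symplectic) D₀.nonempty_unitHatSlice_iso_normalize unit,
    rfl, rfl, fun i => 𝔊.total.ι i,
    fun i => 𝔊.Ĝ (fun i => (P i).D) (fun i => (P i).pol) θhat (fun i j => (R i j).2.2.1) (fun i j => (R i j).2.2.2)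
      D₀.normalize i,
    fun i => 𝔊.isBaseChangeVia_chartTriple (fun i => (P i).D) (fun i => (P i).pol) θhat (fun i j => (R i j).2.2.1)
      (fun i j => (R i j).2.2.2) D₀.normalize (fun i => (P i).level) (fun i j => (R i j).1) (fun i => (P i).relDim) hδ
      (fun i => (P i).hasType) (fun i => (P i).symplectic) D₀.nonempty_unitHatSlice_iso_normalize unit i⟩

end OverRat

end PolarizedAbelianSchemeWithLevel

end Literature.AlgebraicGeometry.AbelianSchemes

end
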